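import Literature.NumberTheory.EllipticCurves.RingClassFieldGenusProofs
import Literature.NumberTheory.EllipticCurves.TwoTorsionOddDegreeBaseChangeProofs
import Literature.NumberTheory.EllipticCurves.HeegnerPointsGaloisDescent
import Literature.NumberTheory.EllipticCurves.Rank1Residual.Predicates
import Literature.NumberTheory.EllipticCurves.YanZhu2026.TwistGoodOrdinaryProofs
import HarnessLib

/-!
# No `2`-torsion over the ring class fields `K[n]` for a curve with surjective `ρ̄_{E,2}` whose
# discriminant has square class `±q`, `q` a prime unramified in `K` — and the descent of
# `2`-power divisibility from `E(K[n])` to `E(K)` (the "`M₀` seam" of a Kolyvagin argument at `p = 2`)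

Topic `NumberTheory/EllipticCurves` (ring class fields `K[n] = ringClassField K ι n ⊂ ℂ` of an
imaginary quadratic field `K`, `HeegnerPointsOfConductor.lean`). THEOREMS ONLY (no definition, no
named fact, no instance, no notation; D-0014/D-0026). Cell `bsd-print-cf2` (HOME
`run/shared/lean/pub/bsd-print-cf2/`), literature seat g11, for the line
route-BirchSwinnertonDyer-CMKolyvaginAtInertTwo, items 22836/22837 (their binder `M₀` = the exact
`2`-divisibility exponent of `P(1) = y_K` in `E(K[1])`; DOSSIER §21.2/§21.5/§21.6).

HONEST FRAMING: elementary Galois theory assembled from PROVED tree theorems; nothing about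
`L`-functions, Selmer groups or the Birch–Swinnerton-Dyer conjecture is asserted; nothing is booked.

## What is proved (all sorry-free; complements ty2's `TwoTorsionOddDegreeBaseChangeProofs.lean`,
## which does `E(K[1])[2] = 0` for `3 ∤ h_K` by degrees and leaves the genus-theory case)

* §1 `exists_sq_eq_Δ_of_two_nsmul_eq_zero` — for `W/ℚ` elliptic with `ρ̄_{W,2}` onto,
  `[K:ℚ] = 2`, `L/K` finite normal: **a point of order `2` in `E(L)` makes `Δ(W)` a square in
  `L`.** PROOF (Dokchitser–Dokchitser 2012, proof of Thm. (1): "`ℚ(E[2]) ⊃ ℚ(√Δ)`"): the point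
  gives a root in `L` of the `2`-division cubic `4x³ + b₂x² + 2b₄x + b₆` (tree
  `isRoot_twoTorsionPolynomial_of_add_self_eq_zero`); `E(K)` has no point of order `2` (ty2's
  `forall_two_nsmul_baseChange_of_hasSurjectiveModNGaloisRep_two_of_finrank_eq_two`: D–D (1) over
  `ℚ`, then degree `3` against `[K:ℚ] = 2`), so the cubic is irreducible over `K`
  (`irreducible_twoTorsionPolynomial_of_forall_two_nsmul`), hence a unit multiple of the minimal
  polynomial of that root, and SPLITS in the normal `L`; with roots `e₁, e₂, e₃ ∈ L` its
  discriminant `16·Δ(W)` (Mathlib `twoTorsionPolynomial_discr`) is `(16·(e₁−e₂)(e₁−e₃)(e₂−e₃))²`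
  (`Cubic.discr_eq_prod_three_roots`), i.e. `Δ = (4δ)²`.
* §2 `twoTorsion_eq_zero_ringClassField` (+ `_zsmul`) — with moreover `Δ(W) = d·s²` (`s ∈ ℚ`) for
  an integer `d` exactly divisible by a prime `q`, `K` imaginary quadratic with `q ∤ d_K`, and
  `n ≥ 1` with `q ∤ n`: **every `P ∈ E(K[n])` with `2P = O` is `O`** — `E(K[n])[2] = 0`
  (`K[n]/K` is finite Galois, `finiteDimensional_and_isGalois_ringClassField`; by §1 `√Δ ∈ K[n]`,
  so `√d = √Δ/s ∈ K[n]`, contradicting the tree's PROVED genus-theory non-membership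
  `sqrt_intCast_not_mem_ringClassField`: `√d ∉ K[n]` for `q ∥ d`, `q ∤ n·d_K`, Cox §9.A — the
  primes of `K` ramified in `K[n]` divide `n`).
* §3 `exists_Δ_eq_mul_sq_of_cmInert_two` — for `W` with `CMInert W 2` (the CM field
  `F = ℚ(√d_F)`, `d_F = cmFieldDiscrOfJ j(W) ∈ {−3, −11, −19, −43, −67, −163}`, has `2` inert):
  **`Δ(W) = d·s²` with `d = d_F` or `d = −d_F`** (`d = +3` exactly at `j = 54000`), from the
  identity `Δ·(j − 1728) = c₆²` (`1728·Δ = −c₆²` at `j = 0`) and the square classes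
  `j − 1728 = 3·132², −3·2024², −11·56², −19·216², −43·4536², −67·46872², −163·40133016²` at the
  eight `j` with `d_F` in that list (Silverman *AT* App. A §3);
  `twoTorsion_eq_zero_ringClassField_of_cmInert_two` — **`E(K[n])[2] = 0`** for `W` with
  `ρ̄_{W,2}` onto and `CMInert W 2`, `K` imaginary quadratic with `|d_F| ∤ d_K`, `|d_F| ∤ n`;
  `…_of_heegner` — the same with `|d_F| ∤ d_K` replaced by `|d_F| ∣ N(W)` and the Heegner
  hypothesis for `(N(W), K)` (the primes of the level split, hence are unramified, in `K`:
  `not_dvd_discr_of_ncard_primesOver_eq_two`). The input `|d_F| ∣ N(W)` ("a CM curve is bad at the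
  odd prime ramified in its CM field") is the Summit-side theorem
  `Summit.BirchSwinnertonDyer.Rank1Residual.X12.not_good_of_hasCM_of_dvd_cmFieldDiscrOfJ` with
  `WeierstrassCurve.dvd_conductorNorm_iff_not_hasGoodReductionAtPrime`, supplied by the consumer (a
  Literature file cannot import `Summits/`).
* §4 `exists_two_pow_nsmul_eq_of_isGalois` / `…_of_ringClassField` — **the seam**: if
  `E(L)[2] = 0` for `L/K` Galois (e.g. `L = K[n]` by §3) then for `P₀ ∈ E(K)` and every `k`,
  `P₀ ∈ 2^k E(L) ⟹ P₀ ∈ 2^k E(K)` (for `σ ∈ Gal(L/K)` and `2^k Q = P₀`, `2^k(σQ − Q) = 0`, so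
  `σQ = Q` — ty2's `two_pow_nsmul_injective_of_forall_two_nsmul` — and `Q` descends: Galois
  descent of points, Silverman *AEC* VIII.1, tree `exists_map_eq_of_forall_map_galois_eq`); the
  `iff` `two_pow_nsmul_ringClassField_iff`, and the `CMInert 2` packagings
  `two_pow_nsmul_ringClassField_one_iff_of_cmInert_two` / `natCast_two_pow_zsmul_…` (the items'
  scalar shape `((2 ^ M : ℕ) : ℤ) • Q`). For items 22836/22837: the typed `M₀` (divisibility of
  `y_K` in `E(K[1])`) IS McCallum's `M₀` (divisibility in `E(K)`; LMS 153 §5, Lemma 5.1 device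
  "`E(K₁)` has no `p`-torsion", here at `p = 2`) on the whole habitat, `3 ∣ h_K` included.

Instances: the statements over `K[n] ⊂ ℂ` are elaborated with the default (`Subtype`/`Complex`)
decidable equality on coordinates, exactly as the items are; the generic lemmas (any field `L`)
use the classical one, and `convert` bridges the two (same device as in ty2's file, §5 there).

## References

* T. Dokchitser, V. Dokchitser, *Surjectivity of mod `2ⁿ` representations of elliptic curves*,
  Math. Z. 272 (2012) 961–964: Theorem (1) and its proof ("`ℚ(E[2]) ⊃ ℚ(√Δ)`").
  [DokchitserDokchitserMathZ2012]
* D. A. Cox, *Primes of the form x² + ny²*, 2nd ed. (2013): §9.A p. 180 (ramification in ring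
  class fields), §6.A Thm. 6.1 (genus field). [Cox2013]
* W. G. McCallum, *Kolyvagin's work on Shafarevich–Tate groups*, LMS Lecture Note Ser. 153 (1991)
  295–316: §5, Lemma 5.1 (p. 304). [McCallumLMS1991]
* J. H. Silverman, *The Arithmetic of Elliptic Curves*, GTM 106 (2009): III.1 (the `2`-division
  cubic, `c₄³ − c₆² = 1728Δ`, `j = c₄³/Δ`), III.2.3(d), VIII.1 (Galois descent of points);
  *Advanced Topics* (1994) App. A §3 (CM `j`-invariants). [SilvermanAEC2009] [SilvermanATAEC1994]
* J. Neukirch, *Algebraic Number Theory* (1999), Ch. III Cor. (2.12). [NeukirchANT1999]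
-/

set_option autoImplicit false

noncomputable section

open scoped Classical

open Polynomial NumberField WeierstrassCurve

namespace Literature.NumberTheory.EllipticCurves

/-! ### §1 A point of order `2` over a normal extension `L/K` puts `√Δ` in `L` -/

section SqrtDisc

variable (W : WeierstrassCurve ℚ) [W.IsElliptic] {K : Type} [Field K] [NumberField K]
  {L : Type*} [Field L] [CharZero L] [Algebra K L]

omit [W.IsElliptic] in
/-- The `2`-division cubic commutes with base change, as a polynomial (the tree's
`OrdinaryPrimesProofs.map_twoTorsionPolynomial` / ty2's private `twoTorsionCubic_toPoly_map`,
restated privately to keep the imports light). [folklore] -/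
private theorem twoTorsionCubic_toPoly_baseChange :
    (W.baseChange L).twoTorsionPolynomial.toPoly = W.twoTorsionPolynomial.toPoly.map (algebraMap ℚ L) := by
  rw [← Cubic.map_toPoly]
  congr 1
  simp [baseChange, twoTorsionPolynomial, Cubic.map, map_b₂, map_b₄, map_b₆, map_ofNat]

/-- **`E(L) ∋ P` of order `2`, `L/K` finite normal, `ρ̄_{E,2}` onto, `[K:ℚ] = 2` ⟹ `Δ(W)` is a
square in `L`.** The abscissa of `P` is a root in `L` of the `2`-division cubic
`4x³ + b₂x² + 2b₄x + b₆`; since `E(K)` has no point of order `2`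
(`forall_two_nsmul_baseChange_of_hasSurjectiveModNGaloisRep_two_of_finrank_eq_two`: Dokchitser–
Dokchitser (1) over `ℚ`, then degree `3` versus `[K:ℚ] = 2`), the cubic is irreducible over `K`
(`irreducible_twoTorsionPolynomial_of_forall_two_nsmul`), hence a unit multiple of the minimal
polynomial of that root, so it SPLITS in the normal `L`; with roots `e₁, e₂, e₃ ∈ L`,
`16·Δ = (16·(e₁−e₂)(e₁−e₃)(e₂−e₃))²` (`Cubic.discr_eq_prod_three_roots`, `twoTorsionPolynomial_discr`),
i.e. `Δ = (4δ)²` — "`ℚ(E[2])` contains `ℚ(√Δ)`".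
[cite: DokchitserDokchitserMathZ2012, Theorem (1), proof (first paragraph)] [cite: SilvermanAEC2009, III.1] -/
theorem exists_sq_eq_Δ_of_two_nsmul_eq_zero [FiniteDimensional K L] [Normal K L]
    (hs : W.HasSurjectiveModNGaloisRep 2) (h2K : Module.finrank ℚ K = 2)
    {P : (W.baseChange L).toAffine.Point} (hP0 : P ≠ 0) (hP : 2 • P = 0) :
    ∃ r : L, r ^ 2 = algebraMap ℚ L W.Δ := by
  haveI : (W.baseChange K).IsElliptic := by rw [baseChange]; infer_instance
  -- the abscissa of `P` is a root of the cubic over `L`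
  rcases P with _ | ⟨x, y, h⟩
  · exact absurd rfl hP0
  have hroot : (W.baseChange L).twoTorsionPolynomial.toPoly.IsRoot x :=
    ((W.baseChange L).isRoot_twoTorsionPolynomial_of_add_self_eq_zero (by rwa [two_nsmul] at hP)).2
  have hcomp : (algebraMap K L).comp (algebraMap ℚ K) = algebraMap ℚ L := RingHom.ext_rat _ _
  have hfK : (W.baseChange K).twoTorsionPolynomial.toPoly =
      W.twoTorsionPolynomial.toPoly.map (algebraMap ℚ K) := twoTorsionCubic_toPoly_baseChange W
  have hfL : (W.baseChange L).twoTorsionPolynomial.toPoly =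
      ((W.baseChange K).twoTorsionPolynomial.toPoly).map (algebraMap K L) := by
    rw [hfK, Polynomial.map_map, hcomp]
    exact twoTorsionCubic_toPoly_baseChange W
  rw [hfL] at hroot
  -- the cubic over `K` is irreducible, so a unit multiple of `minpoly K x`, which splits in `L`
  have hnoK : ∀ Q : (W.baseChange K).toAffine.Point, 2 • Q = 0 → Q = 0 :=
    forall_two_nsmul_baseChange_of_hasSurjectiveModNGaloisRep_two_of_finrank_eq_two W hs K h2K
  have hirr : Irreducible (W.baseChange K).twoTorsionPolynomial.toPoly :=
    (W.baseChange K).irreducible_twoTorsionPolynomial_of_forall_two_nsmul two_ne_zero hnoK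
  have haeval : aeval x (W.baseChange K).twoTorsionPolynomial.toPoly = 0 := by
    rwa [aeval_def, ← eval_map]
  have hmin := minpoly.eq_of_irreducible hirr haeval
  have hlc : (W.baseChange K).twoTorsionPolynomial.toPoly.leadingCoeff ≠ 0 :=
    leadingCoeff_ne_zero.mpr hirr.ne_zero
  have hsplitMin : ((minpoly K x).map (algebraMap K L)).Splits := Normal.splits inferInstance x
  have hsplit : (((W.baseChange K).twoTorsionPolynomial.toPoly).map (algebraMap K L)).Splits := by
    rw [← hmin, Polynomial.map_mul, Polynomial.map_C] at hsplitMin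
    exact (splits_mul_iff_left (C_ne_zero.mpr (by simpa using hlc)) (Splits.C _)).mp hsplitMin
  -- hence the cubic has three roots in `L`, and `16Δ = (4·4·δ)²`
  have ha : W.twoTorsionPolynomial.a ≠ 0 := by change (4 : ℚ) ≠ 0; norm_num
  have hsplit' : (W.twoTorsionPolynomial.toPoly.map (algebraMap ℚ L)).Splits := by
    rwa [hfK, Polynomial.map_map, hcomp] at hsplit
  obtain ⟨e₁, e₂, e₃, h3⟩ := (Cubic.splits_iff_roots_eq_three ha).mp hsplit'
  have hdisc := Cubic.discr_eq_prod_three_roots ha h3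
  have ha4 : W.twoTorsionPolynomial.a = 4 := rfl
  rw [twoTorsionPolynomial_discr, ha4, map_mul, map_ofNat, map_ofNat] at hdisc
  refine ⟨4 * ((e₁ - e₂) * (e₁ - e₃) * (e₂ - e₃)), ?_⟩
  have h16ne : (16 : L) ≠ 0 := by norm_num
  apply mul_left_cancel₀ h16ne
  rw [hdisc]; ring

end SqrtDisc

/-! ### §2 `E(K[n])[2] = 0` -/

section Main

variable (W : WeierstrassCurve ℚ) [W.IsElliptic] {K : Type} [Field K] [NumberField K]

/-- **No `2`-torsion over the ring class field `K[n]`.** Let `W/ℚ` be elliptic with `ρ̄_{W,2}`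
onto and `Δ(W) = d·s²` for a rational `s` and an integer `d` exactly divisible by a prime `q`
(`q ∣ d`, `q² ∤ d`); let `K` be imaginary quadratic with `q ∤ d_K`, `ι : K → ℂ`, and `n ≠ 0` with
`q ∤ n`. Then every `P ∈ E(K[n])` with `2P = O` is `O`. (By §1 — `K[n]/K` is finite Galois,
`finiteDimensional_and_isGalois_ringClassField` — `√Δ ∈ K[n]`, so `√d = √Δ/s ∈ K[n]`,
contradicting `sqrt_intCast_not_mem_ringClassField`: `K(√d)/K` ramifies above `q`, while `K[n]/K`
is unramified outside `n`, Cox §9.A.) The statement is elaborated with the default (`Subtype`)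
decidable equality of `K[n] ⊂ ℂ`, as in the items; `convert` bridges to the classical one of §1.
[cite: Cox2013, §9.A p. 180] [cite: DokchitserDokchitserMathZ2012, Theorem (1), proof] -/
theorem twoTorsion_eq_zero_ringClassField (hs : W.HasSurjectiveModNGaloisRep 2)
    {d : ℤ} {s : ℚ} (hΔ : W.Δ = d * s ^ 2) {q : ℕ} (hq : q.Prime) (hqd : (q : ℤ) ∣ d)
    (hq2d : ¬ (q : ℤ) ^ 2 ∣ d) (hK : IsImaginaryQuadratic K) (ι : K →+* ℂ)
    (hqK : ¬ (q : ℤ) ∣ NumberField.discr K) {n : ℕ} (hn : n ≠ 0) (hqn : ¬ q ∣ n)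
    (P : (W.baseChange (ringClassField K ι n)).toAffine.Point) (hP : 2 • P = 0) : P = 0 := by
  by_contra hP0
  haveI := (finiteDimensional_and_isGalois_ringClassField hK ι hn).1
  haveI := (finiteDimensional_and_isGalois_ringClassField hK ι hn).2
  obtain ⟨r, hr⟩ := exists_sq_eq_Δ_of_two_nsmul_eq_zero W (L := ringClassField K ι n) hs hK.1 hP0
    (by convert hP)
  have hΔ0 : W.Δ ≠ 0 := by rw [← coe_Δ']; exact W.Δ'.ne_zero
  have hs0 : s ≠ 0 := by
    rintro rfl
    exact hΔ0 (by rw [hΔ]; ring)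
  -- `r / s ∈ K[n]` has square `d`
  have hrs_mem : (r : ℂ) / (s : ℂ) ∈ ringClassField K ι n :=
    div_mem r.2 (SubfieldClass.ratCast_mem _ s)
  have hrC : ((r : ℂ)) ^ 2 = ((W.Δ : ℚ) : ℂ) := by
    have h' := congrArg (fun z : ringClassField K ι n ↦ (z : ℂ)) hr
    simpa using h'
  have hsC : (s : ℂ) ≠ 0 := by exact_mod_cast hs0
  have hr' : ((r : ℂ) / (s : ℂ)) ^ 2 = (d : ℂ) := by
    rw [div_pow, hrC, hΔ]
    push_cast
    rw [mul_div_assoc, div_self (pow_ne_zero 2 hsC), mul_one]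
  exact sqrt_intCast_not_mem_ringClassField hK ι hn hq hqd hq2d hqn hqK _ hr' hrs_mem

/-- `ℤ`-scalar form (the items write `(2 : ℤ) • Q` over `E(K[1])`).
[cite: Cox2013, §9.A p. 180] [cite: DokchitserDokchitserMathZ2012, Theorem (1)] -/
theorem twoTorsion_eq_zero_ringClassField_zsmul (hs : W.HasSurjectiveModNGaloisRep 2)
    {d : ℤ} {s : ℚ} (hΔ : W.Δ = d * s ^ 2) {q : ℕ} (hq : q.Prime) (hqd : (q : ℤ) ∣ d)
    (hq2d : ¬ (q : ℤ) ^ 2 ∣ d) (hK : IsImaginaryQuadratic K) (ι : K →+* ℂ)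
    (hqK : ¬ (q : ℤ) ∣ NumberField.discr K) {n : ℕ} (hn : n ≠ 0) (hqn : ¬ q ∣ n)
    (P : (W.baseChange (ringClassField K ι n)).toAffine.Point) (hP : (2 : ℤ) • P = 0) : P = 0 :=
  twoTorsion_eq_zero_ringClassField W hs hΔ hq hqd hq2d hK ι hqK hn hqn P
    (by rwa [← natCast_zsmul, Nat.cast_ofNat])

end Main

/-! ### §3 The square class of `Δ` on the `CMInert 2` classes, and `E(K[n])[2] = 0` there -/

section CM

open Rank1Residual

variable (W : WeierstrassCurve ℚ) [W.IsElliptic]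

/-- `Δ · (j − 1728) = c₆²` for every elliptic curve over a field (`1728Δ = c₄³ − c₆²`,
`j = c₄³/Δ`). [cite: SilvermanAEC2009, III.1 (c₄³ − c₆² = 1728Δ, j = c₄³/Δ)] -/
theorem Δ_mul_j_sub_eq_c₆_sq {F : Type*} [Field F] (V : WeierstrassCurve F) [V.IsElliptic] :
    V.Δ * (V.j - 1728) = V.c₆ ^ 2 := by
  rw [WeierstrassCurve.j]
  have hinv : ((V.Δ'⁻¹ : Fˣ) : F) * V.Δ = 1 := by
    rw [← coe_Δ', Units.inv_mul]
  linear_combination -V.c_relation + V.c₄ ^ 3 * hinv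

/-- At `c₄ = 0` (`j = 0`): `1728·Δ = −c₆²`. [cite: SilvermanAEC2009, III.1] -/
theorem Δ_eq_of_c₄_eq_zero {F : Type*} [Field F] (V : WeierstrassCurve F) (h4 : V.c₄ = 0) :
    1728 * V.Δ = -V.c₆ ^ 2 := by
  have hc := V.c_relation
  rw [h4] at hc
  linear_combination hc

/-- If `j(W) = j₀` with `j₀ − 1728 = d·t²`, `d, t ≠ 0`, then `Δ(W) = d·s²` for a rational `s`.
[cite: SilvermanAEC2009, III.1] -/
theorem exists_Δ_eq_mul_sq_of_j_eq {j₀ : ℚ} (hj : W.j = j₀) {d : ℤ} {t : ℚ} (hd : d ≠ 0)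
    (ht : t ≠ 0) (hjt : j₀ - 1728 = d * t ^ 2) : ∃ s : ℚ, W.Δ = d * s ^ 2 := by
  have h := Δ_mul_j_sub_eq_c₆_sq W
  rw [hj, hjt] at h
  refine ⟨W.c₆ / (d * t), ?_⟩
  have hd' : (d : ℚ) ≠ 0 := by exact_mod_cast hd
  field_simp
  linear_combination h

/-- `CMInert W 2` pins the CM-field discriminant `d_F = cmFieldDiscrOfJ j(W)` to the six odd
class-number-one values (the definition's `2 ∤ d_F ∧ d_F ≢ 1 (mod 8)` on the thirteen-value table).
[cite: SilvermanATAEC1994, App. A §3] -/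
theorem cmFieldDiscrOfJ_mem_of_cmInert_two (h : CMInert W 2) :
    cmFieldDiscrOfJ W.j = -3 ∨ cmFieldDiscrOfJ W.j = -11 ∨ cmFieldDiscrOfJ W.j = -19 ∨
      cmFieldDiscrOfJ W.j = -43 ∨ cmFieldDiscrOfJ W.j = -67 ∨ cmFieldDiscrOfJ W.j = -163 := by
  obtain ⟨hram, hsplit⟩ := h
  unfold CMRamified at hram
  unfold CMSplit at hsplit
  simp only [↓reduceIte, not_and] at hsplit
  generalize hd : cmFieldDiscrOfJ W.j = d at *
  have hd' : d = -3 ∨ d = -4 ∨ d = -7 ∨ d = -8 ∨ d = -11 ∨ d = -19 ∨ d = -43 ∨ d = -67 ∨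
      d = -163 ∨ d = 0 := by
    rw [← hd]; unfold cmFieldDiscrOfJ; split_ifs <;> simp
  rcases hd' with rfl | rfl | rfl | rfl | rfl | rfl | rfl | rfl | rfl | rfl <;> simp_all

/-- `CMInert W 2` pins `j(W)` to eight of the thirteen CM `j`-invariants.
[cite: SilvermanATAEC1994, App. A §3 (table of CM j-invariants)] -/
theorem j_mem_of_cmInert_two (h : CMInert W 2) :
    W.j = 0 ∨ W.j = 54000 ∨ W.j = -12288000 ∨ W.j = -32768 ∨ W.j = -884736 ∨
      W.j = -884736000 ∨ W.j = -147197952000 ∨ W.j = -262537412640768000 := by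
  have hmem := cmFieldDiscrOfJ_mem_of_cmInert_two W h
  unfold cmFieldDiscrOfJ at hmem
  split_ifs at hmem with h1 h2 h3 h4 h5 h6 h7 h8 h9 <;> norm_num at hmem <;> tauto

/-- **On `CMInert W 2`, `Δ(W) = d·s²` with `d = ±d_F`** (`d_F = cmFieldDiscrOfJ j(W)`): by the
table of CM `j`-invariants, `d_F = −3 ⟺ j ∈ {0, 54000, −12288000}` and `d_F = −q ⟺ j = j_q` for
`q = 11, 19, 43, 67, 163`; then `Δ·(j − 1728) = c₆²` (resp. `1728Δ = −c₆²` at `j = 0`) with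
`j − 1728 = 3·132²` (j = 54000), `−3·2024²`, `−11·56²`, `−19·216²`, `−43·4536²`, `−67·46872²`,
`−163·40133016²`. [cite: SilvermanATAEC1994, App. A §3 (table of CM j-invariants)] [cite: SilvermanAEC2009, III.1] -/
theorem exists_Δ_eq_mul_sq_of_cmInert_two (h : CMInert W 2) :
    ∃ d : ℤ, (d = cmFieldDiscrOfJ W.j ∨ d = -cmFieldDiscrOfJ W.j) ∧ ∃ s : ℚ, W.Δ = d * s ^ 2 := by
  rcases j_mem_of_cmInert_two W h with hj | hj | hj | hj | hj | hj | hj | hj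
  · -- `j = 0`: `c₄ = 0`, `Δ = −3·(c₆/72)²`
    have hc4 : W.c₄ = 0 := W.j_eq_zero_iff.mp hj
    have hΔ := Δ_eq_of_c₄_eq_zero W hc4
    refine ⟨-3, Or.inl ?_, W.c₆ / 72, ?_⟩
    · rw [hj]; unfold cmFieldDiscrOfJ; norm_num
    · push_cast; linear_combination (1 / 1728 : ℚ) * hΔ
  · obtain ⟨s, hs⟩ := exists_Δ_eq_mul_sq_of_j_eq W hj (d := 3) (t := 132) (by norm_num)
      (by norm_num) (by norm_num)
    refine ⟨3, Or.inr ?_, s, hs⟩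
    rw [hj]; unfold cmFieldDiscrOfJ; norm_num
  · obtain ⟨s, hs⟩ := exists_Δ_eq_mul_sq_of_j_eq W hj (d := -3) (t := 2024) (by norm_num)
      (by norm_num) (by norm_num)
    refine ⟨-3, Or.inl ?_, s, hs⟩
    rw [hj]; unfold cmFieldDiscrOfJ; norm_num
  · obtain ⟨s, hs⟩ := exists_Δ_eq_mul_sq_of_j_eq W hj (d := -11) (t := 56) (by norm_num)
      (by norm_num) (by norm_num)
    refine ⟨-11, Or.inl ?_, s, hs⟩
    rw [hj]; unfold cmFieldDiscrOfJ; norm_num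
  · obtain ⟨s, hs⟩ := exists_Δ_eq_mul_sq_of_j_eq W hj (d := -19) (t := 216) (by norm_num)
      (by norm_num) (by norm_num)
    refine ⟨-19, Or.inl ?_, s, hs⟩
    rw [hj]; unfold cmFieldDiscrOfJ; norm_num
  · obtain ⟨s, hs⟩ := exists_Δ_eq_mul_sq_of_j_eq W hj (d := -43) (t := 4536) (by norm_num)
      (by norm_num) (by norm_num)
    refine ⟨-43, Or.inl ?_, s, hs⟩
    rw [hj]; unfold cmFieldDiscrOfJ; norm_num
  · obtain ⟨s, hs⟩ := exists_Δ_eq_mul_sq_of_j_eq W hj (d := -67) (t := 46872) (by norm_num)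
      (by norm_num) (by norm_num)
    refine ⟨-67, Or.inl ?_, s, hs⟩
    rw [hj]; unfold cmFieldDiscrOfJ; norm_num
  · obtain ⟨s, hs⟩ := exists_Δ_eq_mul_sq_of_j_eq W hj (d := -163) (t := 40133016) (by norm_num)
      (by norm_num) (by norm_num)
    refine ⟨-163, Or.inl ?_, s, hs⟩
    rw [hj]; unfold cmFieldDiscrOfJ; norm_num

/-- On `CMInert W 2`, `q := |d_F|` is a prime. [cite: SilvermanATAEC1994, App. A §3] -/
theorem prime_natAbs_cmFieldDiscrOfJ_of_cmInert_two (h : CMInert W 2) :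
    (cmFieldDiscrOfJ W.j).natAbs.Prime := by
  rcases cmFieldDiscrOfJ_mem_of_cmInert_two W h with h | h | h | h | h | h <;> rw [h] <;> norm_num

/-- `d = ±d_F` is exactly divisible by the prime `|d_F|`. [folklore] -/
private theorem natAbs_dvd_and_not_sq_dvd_of_eq_or_eq_neg {dF d : ℤ} (hp : dF.natAbs.Prime)
    (hd : d = dF ∨ d = -dF) : (dF.natAbs : ℤ) ∣ d ∧ ¬ (dF.natAbs : ℤ) ^ 2 ∣ d := by
  have hdabs : d.natAbs = dF.natAbs := by rcases hd with rfl | rfl <;> simp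
  refine ⟨?_, fun h2 ↦ ?_⟩
  · rw [← hdabs, Int.natAbs_dvd]
  · have h' : dF.natAbs ^ 2 ∣ d.natAbs := by
      have := Int.natAbs_dvd_natAbs.mpr h2
      simpa [Int.natAbs_pow] using this
    rw [hdabs, sq] at h'
    have hle := Nat.le_of_dvd hp.pos h'
    nlinarith [hp.one_lt]

/-- **`E(K[n])[2] = 0` on the `CMInert 2` classes.** For `W/ℚ` elliptic with `ρ̄_{W,2}` onto and
`CMInert W 2` (CM field `F` with `2` inert, `q = |d_F| ∈ {3, 11, 19, 43, 67, 163}`), `K` imaginary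
quadratic with `q ∤ d_K`, `ι : K → ℂ`, `n ≠ 0` with `q ∤ n`: every `P ∈ E(K[n])` with `2P = O`
is `O`. [cite: Cox2013, §9.A p. 180] [cite: DokchitserDokchitserMathZ2012, Theorem (1)] [cite: SilvermanATAEC1994, App. A §3] -/
theorem twoTorsion_eq_zero_ringClassField_of_cmInert_two (hsurj : W.HasSurjectiveModNGaloisRep 2)
    (hinert : CMInert W 2) {K : Type} [Field K] [NumberField K] (hK : IsImaginaryQuadratic K)
    (ι : K →+* ℂ) (hqK : ¬ ((cmFieldDiscrOfJ W.j).natAbs : ℤ) ∣ NumberField.discr K) {n : ℕ}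
    (hn : n ≠ 0) (hqn : ¬ (cmFieldDiscrOfJ W.j).natAbs ∣ n)
    (P : (W.baseChange (ringClassField K ι n)).toAffine.Point) (hP : 2 • P = 0) : P = 0 := by
  obtain ⟨d, hd, s, hs⟩ := exists_Δ_eq_mul_sq_of_cmInert_two W hinert
  have hq := prime_natAbs_cmFieldDiscrOfJ_of_cmInert_two W hinert
  obtain ⟨hqd, hq2d⟩ := natAbs_dvd_and_not_sq_dvd_of_eq_or_eq_neg hq hd
  exact twoTorsion_eq_zero_ringClassField W hsurj hs hq hqd hq2d hK ι hqK hn hqn P hP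

/-- **`E(K[n])[2] = 0` on the `CMInert 2` classes, Heegner form**: as above with `q ∤ d_K`
replaced by `q ∣ N(W)` and the Heegner hypothesis for `(N(W), K)` (the primes of the level split,
hence are unramified, in `K`). The input `q ∣ N(W)` is
`Summit.BirchSwinnertonDyer.Rank1Residual.X12.not_good_of_hasCM_of_dvd_cmFieldDiscrOfJ` +
`WeierstrassCurve.dvd_conductorNorm_iff_not_hasGoodReductionAtPrime` on the consumer's side.
[cite: Cox2013, §9.A p. 180] [cite: NeukirchANT1999, Ch. III Cor. (2.12)] -/
theorem twoTorsion_eq_zero_ringClassField_of_cmInert_two_of_heegner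
    (hsurj : W.HasSurjectiveModNGaloisRep 2) (hinert : CMInert W 2) {K : Type} [Field K]
    [NumberField K] (hK : IsImaginaryQuadratic K) (ι : K →+* ℂ)
    (hH : SatisfiesHeegnerHypothesis (W.conductorNorm ℤ) K)
    (hqN : (cmFieldDiscrOfJ W.j).natAbs ∣ W.conductorNorm ℤ) {n : ℕ} (hn : n ≠ 0)
    (hqn : ¬ (cmFieldDiscrOfJ W.j).natAbs ∣ n)
    (P : (W.baseChange (ringClassField K ι n)).toAffine.Point) (hP : 2 • P = 0) : P = 0 :=
  have hq := prime_natAbs_cmFieldDiscrOfJ_of_cmInert_two W hinert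
  twoTorsion_eq_zero_ringClassField_of_cmInert_two W hsurj hinert hK ι
    (not_dvd_discr_of_ncard_primesOver_eq_two hK.1 hq (hH _ hq hqN)) hn hqn P hP

end CM

/-! ### §4 The seam: `2`-power divisibility descends from `E(K[n])` to `E(K)` -/

section Seam

variable (W : WeierstrassCurve ℚ) {K : Type} [Field K] [NumberField K]

/-- `Gal(L/K)` fixes the image of `E(K)` in `E(L)` (it fixes coordinates from `K`). [folklore] -/
private theorem pointMap_gal_map_algebraMap {L : Type*} [Field L] [CharZero L] [Algebra K L]
    (σ : L ≃ₐ[K] L) (P₀ : (W.baseChange K).toAffine.Point) :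
    Affine.Point.map (W' := W) (σ : L →ₐ[K] L)
        (Affine.Point.map (W' := W) (algebraMap K L).toRatAlgHom P₀) =
      Affine.Point.map (W' := W) (algebraMap K L).toRatAlgHom P₀ := by
  rcases P₀ with _ | ⟨x, y, h⟩
  · rfl
  · simp only [Affine.Point.map_some, Affine.Point.some.injEq]
    constructor <;> simp

/-- **Descent of `2`-power divisibility along a Galois extension without `2`-torsion** (generic
form): `L/K` Galois of characteristic `0`, `E(L)[2] = 0`; if `P₀ ∈ E(K)` is `2^k`-divisible in
`E(L)` then it is `2^k`-divisible in `E(K)` — for `2^k Q = P₀` and `σ ∈ Gal(L/K)`,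
`2^k (σQ − Q) = 0`, so `σQ = Q` (`two_pow_nsmul_injective_of_forall_two_nsmul`) and `Q` descends
(Galois descent of points, tree `exists_map_eq_of_forall_map_galois_eq`, Silverman *AEC* VIII.1).
McCallum's device "`E(K₁)` has no `p`-torsion" (LMS 153, §5 Lemma 5.1), at `p = 2`.
[cite: McCallumLMS1991, §5 Lemma 5.1 (p. 304)] [cite: SilvermanAEC2009, VIII.1] -/
theorem exists_two_pow_nsmul_eq_of_isGalois {L : Type*} [Field L] [CharZero L] [Algebra K L]
    [IsGalois K L] (h2 : ∀ P : (W.baseChange L).toAffine.Point, 2 • P = 0 → P = 0)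
    (P₀ : (W.baseChange K).toAffine.Point) (k : ℕ)
    (hdiv : ∃ Q : (W.baseChange L).toAffine.Point,
      2 ^ k • Q = Affine.Point.map (W' := W) (algebraMap K L).toRatAlgHom P₀) :
    ∃ Q₀ : (W.baseChange K).toAffine.Point, 2 ^ k • Q₀ = P₀ := by
  obtain ⟨Q, hQ⟩ := hdiv
  have hfix : ∀ σ : L ≃ₐ[K] L, Affine.Point.map (W' := W) (σ : L →ₐ[K] L) Q = Q := by
    intro σ
    have h1 : 2 ^ k • Affine.Point.map (W' := W) (σ : L →ₐ[K] L) Q =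
        Affine.Point.map (W' := W) (algebraMap K L).toRatAlgHom P₀ := by
      rw [← map_nsmul, hQ]
      exact pointMap_gal_map_algebraMap W σ P₀
    exact two_pow_nsmul_injective_of_forall_two_nsmul h2 k (h1.trans hQ.symm)
  obtain ⟨Q₀, hQ₀⟩ := exists_map_eq_of_forall_map_galois_eq W hfix
  refine ⟨Q₀, ?_⟩
  apply Affine.Point.map_injective (W' := W) (f := (algebraMap K L).toRatAlgHom)
  rw [map_nsmul, hQ₀, hQ]

/-- **The `M₀` seam over `K[n]`.** Let `E(K[n])[2] = 0` (e.g. by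
`twoTorsion_eq_zero_ringClassField_of_cmInert_two`). If `P₀ ∈ E(K)` is `2^k`-divisible in
`E(K[n])`, it is `2^k`-divisible in `E(K)` (`K[n]/K` is Galois:
`finiteDimensional_and_isGalois_ringClassField`). The statement is elaborated with the default
(`Subtype`) decidable equality of `K[n] ⊂ ℂ`, as in items 22836/22837; `convert` bridges to the
classical instance of the generic form. [cite: McCallumLMS1991, §5 Lemma 5.1 (p. 304)] [cite: SilvermanAEC2009, VIII.1] -/
theorem exists_two_pow_nsmul_eq_of_ringClassField (hK : IsImaginaryQuadratic K) (ι : K →+* ℂ)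
    {n : ℕ} (hn : n ≠ 0)
    (h2 : ∀ P : (W.baseChange (ringClassField K ι n)).toAffine.Point, 2 • P = 0 → P = 0)
    (P₀ : (W.baseChange K).toAffine.Point) (k : ℕ)
    (hdiv : ∃ Q : (W.baseChange (ringClassField K ι n)).toAffine.Point,
      2 ^ k • Q = Affine.Point.map (W' := W) (algebraMap K (ringClassField K ι n)).toRatAlgHom P₀) :
    ∃ Q₀ : (W.baseChange K).toAffine.Point, 2 ^ k • Q₀ = P₀ := by
  haveI := (finiteDimensional_and_isGalois_ringClassField hK ι hn).2
  obtain ⟨Q, hQ⟩ := hdiv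
  refine exists_two_pow_nsmul_eq_of_isGalois W (L := ringClassField K ι n)
    (fun P hP ↦ h2 P (by convert hP)) P₀ k ⟨Q, ?_⟩
  convert hQ

/-- The converse direction is trivial (map the witness), so the divisibility exponents agree:
**`P₀ ∈ 2^k E(K[n]) ⟺ P₀ ∈ 2^k E(K)`** whenever `E(K[n])[2] = 0`.
[cite: McCallumLMS1991, §5 Lemma 5.1 (p. 304)] -/
theorem two_pow_nsmul_ringClassField_iff (hK : IsImaginaryQuadratic K) (ι : K →+* ℂ) {n : ℕ}
    (hn : n ≠ 0)
    (h2 : ∀ P : (W.baseChange (ringClassField K ι n)).toAffine.Point, 2 • P = 0 → P = 0)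
    (P₀ : (W.baseChange K).toAffine.Point) (k : ℕ) :
    (∃ Q : (W.baseChange (ringClassField K ι n)).toAffine.Point,
      2 ^ k • Q = Affine.Point.map (W' := W) (algebraMap K (ringClassField K ι n)).toRatAlgHom P₀) ↔
    ∃ Q₀ : (W.baseChange K).toAffine.Point, 2 ^ k • Q₀ = P₀ := by
  refine ⟨exists_two_pow_nsmul_eq_of_ringClassField W hK ι hn h2 P₀ k, ?_⟩
  rintro ⟨Q₀, rfl⟩
  exact ⟨Affine.Point.map (W' := W) (algebraMap K (ringClassField K ι n)).toRatAlgHom Q₀,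
    by rw [map_nsmul]⟩

/-- **The seam on the `CMInert 2` classes, packaged for items 22836/22837**: for `W/ℚ` elliptic
with `ρ̄_{W,2}` onto and `CMInert W 2`, `K` imaginary quadratic with `|d_F| ∤ d_K`, and any
`P₀ ∈ E(K)` (e.g. `y_K`): `P₀ ∈ 2^k E(K[1]) ⟺ P₀ ∈ 2^k E(K)` for every `k` — the typed exponent
`M₀` over `E(K[1])` is the exponent over `E(K)`.
[cite: McCallumLMS1991, §5 Lemma 5.1 (p. 304)] [cite: Cox2013, §9.A p. 180] -/
theorem two_pow_nsmul_ringClassField_one_iff_of_cmInert_two [W.IsElliptic]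
    (hsurj : W.HasSurjectiveModNGaloisRep 2) (hinert : Rank1Residual.CMInert W 2)
    (hK : IsImaginaryQuadratic K) (ι : K →+* ℂ)
    (hqK : ¬ ((Rank1Residual.cmFieldDiscrOfJ W.j).natAbs : ℤ) ∣ NumberField.discr K)
    (P₀ : (W.baseChange K).toAffine.Point) (k : ℕ) :
    (∃ Q : (W.baseChange (ringClassField K ι 1)).toAffine.Point,
      2 ^ k • Q = Affine.Point.map (W' := W) (algebraMap K (ringClassField K ι 1)).toRatAlgHom P₀) ↔
    ∃ Q₀ : (W.baseChange K).toAffine.Point, 2 ^ k • Q₀ = P₀ :=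
  have hq := prime_natAbs_cmFieldDiscrOfJ_of_cmInert_two W hinert
  two_pow_nsmul_ringClassField_iff W hK ι one_ne_zero
    (fun P hP ↦ twoTorsion_eq_zero_ringClassField_of_cmInert_two W hsurj hinert hK ι hqK
      one_ne_zero (fun h ↦ hq.one_lt.ne' (Nat.dvd_one.mp h)) P hP) P₀ k

/-- `ℤ`-scalar form of the previous theorem in the items' binder shape
`((2 ^ M : ℕ) : ℤ) • Q`. [cite: McCallumLMS1991, §5 Lemma 5.1 (p. 304)] [cite: Cox2013, §9.A p. 180] -/
theorem natCast_two_pow_zsmul_ringClassField_one_iff_of_cmInert_two [W.IsElliptic]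
    (hsurj : W.HasSurjectiveModNGaloisRep 2) (hinert : Rank1Residual.CMInert W 2)
    (hK : IsImaginaryQuadratic K) (ι : K →+* ℂ)
    (hqK : ¬ ((Rank1Residual.cmFieldDiscrOfJ W.j).natAbs : ℤ) ∣ NumberField.discr K)
    (P₀ : (W.baseChange K).toAffine.Point) (M : ℕ) :
    (∃ Q : (W.baseChange (ringClassField K ι 1)).toAffine.Point,
      ((2 ^ M : ℕ) : ℤ) • Q =
        Affine.Point.map (W' := W) (algebraMap K (ringClassField K ι 1)).toRatAlgHom P₀) ↔
    ∃ Q₀ : (W.baseChange K).toAffine.Point, ((2 ^ M : ℕ) : ℤ) • Q₀ = P₀ := by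
  simp only [natCast_zsmul]
  exact two_pow_nsmul_ringClassField_one_iff_of_cmInert_two W hsurj hinert hK ι hqK P₀ M

end Seam

end Literature.NumberTheory.EllipticCurves

end
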